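import Summits.MatrixMultiplication.OmegaCensus.STPPCell22Checker
import Summits.MatrixMultiplication.OmegaCensus.STPPCell22TablesA
import Summits.MatrixMultiplication.OmegaCensus.STPPZoo313TableP4

/-!
# ω-census (abelian STPP census): cell-(2,2) certificate of the fifth leaf `{(2,2,2),(3,3,3)²} @ ℤ₆₁` — stage 0 rows (y-values, normalisation, shape coverage)

HONEST FRAMING (pub-omega census; verbatim): lottery ticket; floor = certified bounds/negative ranges.
Census STRUCTURE (seat pub-omega-stpp-1 gen 33, 2026-08-29), family (b2).  KERNEL rows (`decide +kernel`) / glue for the checkers of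
`STPPCell22Checker.lean`; design and python ×1 DATUM in HOME `pub-omega-stpp-1-g33/FIFTH-LEAF.md`, generator `code/gen_cell22_rows.py`.
Nothing here is progress on `ω`.
-/

namespace Summit.MatrixMultiplication.OmegaCensus.CubeNB.S2

open Summit.MatrixMultiplication.OmegaCensus.CubeNB.Bits

/-- The y-values occurring in the zoo. [folklore] -/
def ys14 : List ℕ := [2, 3, 4, 16, 20, 21, 30, 31, 32, 41, 42, 46, 58, 59]

/-- **Row (y-values)**: every zoo entry has `y ∈ ys14`. [folklore] -/
theorem zooTbl61_ys : (zooTbl61.all fun e => ys14.elem e.1) = true := by decide +kernel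

/-- **Row (normalisation, part a)**: every zoo entry with `y ∈ {2,3,4}` is listed in `zooNrm61` with its canonical shape and offset. [folklore] -/
theorem zooTbl61a_nrm : (zooTbl61a.all fun e => !([2, 3, 4].elem e.1) || nrmListed 61 zooNrm61 e) = true := by decide +kernel

/-- **Row (normalisation, part b)**. [folklore] -/
theorem zooTbl61b_nrm : (zooTbl61b.all fun e => !([2, 3, 4].elem e.1) || nrmListed 61 zooNrm61 e) = true := by decide +kernel

/-- **Row (normalisation, part c)**. [folklore] -/
theorem zooTbl61c_nrm : (zooTbl61c.all fun e => !([2, 3, 4].elem e.1) || nrmListed 61 zooNrm61 e) = true := by decide +kernel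

/-- **Row (normalisation, part d)**. [folklore] -/
theorem zooTbl61d_nrm : (zooTbl61d.all fun e => !([2, 3, 4].elem e.1) || nrmListed 61 zooNrm61 e) = true := by decide +kernel

/-- **Row (normalisation)**: all of `zooTbl61`. [folklore] -/
theorem zooTbl61_nrm : (zooTbl61.all fun e => !([2, 3, 4].elem e.1) || nrmListed 61 zooNrm61 e) = true := by
  rw [show zooTbl61 = zooTbl61a ++ zooTbl61b ++ zooTbl61c ++ zooTbl61d from rfl]
  simp only [List.all_append, Bool.and_eq_true]
  exact ⟨⟨⟨zooTbl61a_nrm, zooTbl61b_nrm⟩, zooTbl61c_nrm⟩, zooTbl61d_nrm⟩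

/-- **Row (shape coverage)**: the canonical shape of every normalised entry is in `zooShp61`. [folklore] -/
theorem zooNrm61_shp : (zooNrm61.all fun r => decide ((r.1, r.2.2.1) ∈ zooShp61)) = true := by decide +kernel

end Summit.MatrixMultiplication.OmegaCensus.CubeNB.S2
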